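import Literature.MathematicalPhysics.QuantumFieldTheory.BalabanImbrieJaffe1984to88.BIJ85NeumannPropagatorRegularHolder
import Literature.MathematicalPhysics.QuantumFieldTheory.Balaban1983to89.T4TreeGaugeTransform

/-!
# `BalabanImbrieJaffe1984to88.BIJ85ContourTransportDictionary` — T. Bałaban, *Regularity and decay of lattice Green's functions*, Commun. Math.
# Phys. **89** (1983) 571–597 [Balaban1983RegularityDecay] («[7]» of [BalabanImbrieJaffe1985], «[6]» of [BalabanImbrieJaffe1988]), p. 572 (1.4)
# «U(A(Γ))», «A(Γ) = Σ_{b⊂Γ} A_b», p. 573 (1.9) «U(A(Γ_{x,x′}))(D^η_{A,μ}G_k(Ω,A)f)(x′) − (D^η_{A,μ}G_k(Ω,A)f)(x)», at the `U(1)` field «of the form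
# exp[ie_kηA]» of [BalabanImbrieJaffe1985] §7.3 p. 326: **THE CONTOUR TRANSPORT `U(A(Γ)) = e^{ieεA(Γ)}` ON THE `Setup` TORUS — ITS
# LINK-VARIABLE FORM, ITS TELESCOPING AGAINST THE COVARIANT DERIVATIVE `D_u` OF [BalabanImbrieJaffe1988] (3.3), AND THE DICTIONARY WITH THE
# ORDERED HOLONOMY `chainHol` OF THE TREE-GAUGE MODULES (`T4TreeGaugeTransform`).**

statement-level skeleton of published theorems with citation tags; proofs where landed; nothing here is a claim about the Yang–Mills mass gap

PDFs held and re-read on the materialised pages 2026-08-23: `paper:balaban1983-cmp89-regularity-decay` p. 572 [PDF 2] l.19 «U(A) = e^{qeηA}, q is an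
antisymmetric N × N matrix» (1.2), l.29–34 «(Q_k(A)φ)(y) = Σ_{x∈B^k(y)} η^d U(A(Γ^{(k)}_{y,x}))φ(x) (1.4). Here Γ^{(k)}_{y,x} ⊂ B^k(y) are oriented
contours in B^k(y) connecting the initial point y with a final point x. For an arbitrary contour Γ in the lattice ηℤ^d (considered as a sum of bonds) we
define A(Γ) = Σ_{b⊂Γ} A_b, where orientations of the bonds b agree with orientation of the contour Γ.»; p. 573 [PDF 3] l.9–15 «for an arbitrary pair of
points x, x′ ∈ ηℤ^d, let us denote by Γ_{x,x′} a shortest contour connecting these points … |x − x′|^{−α}|U(A(Γ_{x,x′}))(D^η_{A,μ}G_k(Ω, A)f)(x′) −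
(D^η_{A,μ}G_k(Ω, A)f)(x)| ≦ …» (1.9); p. 576 «A_{b̄} = −A_b».  [BalabanImbrieJaffe1988] p. 265 (3.3) «−Δ^ε_u = D^{ε*}_u D^ε_u», the terms
«φ̄(b₋)u(b)φ(b₊)» of (3.1) (r18's `BIJ88Sect3Statements.covD c u φ b = c·(u(b)φ(b₊) − φ(b₋))`).  [BalabanImbrieJaffe1985] p. 326 [PDF 28] «a
configuration of the form exp[ie_kηA]» (this seat's `BIJ85CovariantHiggsDictionary.expGauge`).

CITATION HEADER (lean-in-tree rule).  Cell `lit-balaban` (HOME `run/shared/lean/pub/lit-balaban/`), Phase 2, reader seat **r01 gen 35** (unit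
`lit-balaban-r01`, literature-prover-lit-balaban-r01-g35-0; B4 fold owner).  KERNEL API of the contour vocabulary this seat introduced in
`BIJ85NeumannPropagatorRegularHolder` (gen 26, p348815: `SNbr`/`IsSChain`/`bondSum`/`holA`, where the value of the pair form on a bond was left as the
hypothesis of `holA_single_of_bondSum`), written on the day its first consumer asked for it (r18 gen 25, HOME/STATUS.md 2026-08-23T04:40:17Z, TAKING
`BIJ88LocDerivHolder230RegularTorus` = the order-`1+θ` Hölder member of [BalabanImbrieJaffe1988] (2.30) at a (2.23)-regular `u = e^{ieεA}`: «plus the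
telescoping of `holA` along an `IsSChain` at the non-flat u (new kernel lemma, `holA_cons` + `bondSum_shift`) … tell me if you already have that
lemma somewhere so I import instead» — it was not in the tree; r18 then wrote the two bond-value lemmas and a site-wise telescoping for that one
file, `BIJ88LocDerivHolder230RegularTorus.{bondSum_shift, bondSum_unshift, norm_holA_mul_sub_le}`, p353266, which LANDED FIRST (2026-08-23T05:2xZ,
while this file sat in its objection window): those two bond-value statements are therefore r18's in the tree, cited here and kept only as PRIVATE
kernels (this low-level file must not import that 1450-line consumer module — its successors are the intended importers of THIS file, and the
import graph must stay acyclic); everything public below — §1 `bondSum_self`/`bondSum_swap`/`sNbr_comm`, §2 the link-variable forms, §3 the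
bond-localised telescoping, §4 the dictionary with T4's `chainHol` — exists nowhere else).  Rows served
(cells only, no head change): **B4.Thm@573**
(owner r01: the transport `U(A(Γ_{x,x′}))` of (1.9) on the C2 carrier), **C2.Claim@263 / C2.Eq2.30 / C2.Eq2.31** (owner r18: the Hölder members at
a regular non-flat `u`, whose statements use BOTH contour vocabularies of the `Setup` torus — T4's `chainHol sq cb u n` over site/bond SEQUENCES with
`Joins` (p29 `BIJ88LocHolder231RegularTorus`, `BIJ88LocHolder230RegularTorus`, r18 `BIJ88Close231RegularTorusCwt` §7) and this seat's `holA e A x l`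
over site LISTS with `IsSChain` (`BIJ85NeumannPropagatorRegularHolder.input19_holder_regular_deep`); §4 below is the two-way dictionary between them).
USED BY NAME, never restated: `BIJ85NeumannPropagatorRegularHolder.{SNbr, IsSChain, bondSum, holA, holA_nil, holA_cons, norm_holA}`,
`BIJ85CovariantHiggsDictionary.{expGauge, toC_expGauge}`, r18's `BIJ88Sect3Statements.{U1, toC, cfg, covD, toC_mul, toC_inv, toC_one, norm_toC}`,
`T4TreeGaugeFixing.Joins`, `T4TreeGaugeTransform.{chainHol, chainStep, chainHol_zero, chainHol_succ}`, b04's `B4GaugeCovariance.pathEnd`,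
`B4Lemma22HolderBox.pathSum`.  The twin statements on the (Higgs)₂,₃ torus are p35's `B1TorusChainTransport.{bondVal_shift, bondVal_of_shift}`
(same proofs, there with `hS : ∀ μ, 2 < sitesPerDir k μ`); p29's `BIJ88LocDeriv230SmallFieldTorus.norm_transport_sub_le_sum_covD` is the telescoping
of §3 in the `chainHol` vocabulary (any `U(1)` field) — by §4 the two agree at `u = e^{ieεA}`.

WHAT THIS FILE PROVES (kernel-checked, 0 `sorry`; theorems only — no definition, no `Prop` fact; hypothesis `2 < sitesPerDir 0` = «more than two
sites per direction», automatic on every torus of the series with `1 ≦ m + K` since `sitesPerDir 0 = 2L^{m+K}`, `L ≧ 3`).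
* §1 THE PAIR FORM ON A BOND: private kernels `bondSum_shift` `A(x, x+e_μ) = A_{⟨x,μ⟩}` / `bondSum_of_shift` `A(x+e_μ, x) = −A_{⟨x,μ⟩}` (PUBLIC
  statements of record = r18's `BIJ88LocDerivHolder230RegularTorus.bondSum_shift`/`bondSum_unshift`, landed first); public **`bondSum_self = 0`**,
  **`bondSum_swap`** `A(v,u) = −A(u,v)` (no torus hypothesis), `sNbr_comm`.
* §2 THE LINK VARIABLES OF THE TRANSPORT: **`exp_bondSum_shift`** `e^{ieεA(x,x+e_μ)} = u_{⟨x,μ⟩}` (= `toC (expGauge P e A ⟨x,μ⟩)`),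
  **`exp_bondSum_of_shift`** `e^{ieεA(x+e_μ,x)} = ū_{⟨x,μ⟩}`; hence **`holA_cons_shift`** / **`holA_cons_of_shift`** (one forward / backward step peeled
  off `U(A(Γ))`), **`holA_single_shift`** / **`holA_single_of_shift`**, and **`holA_append`** `U(A(Γ₁Γ₂)) = U(A(Γ₁))U(A(Γ₂))` (with `pathEnd_append`).
* §3 TELESCOPING AGAINST `D_u` ([7] (1.9)'s numerator, one bond at a time): **`norm_link_mul_sub_eq`** `‖u_b ψ(b₊) − ψ(b₋)‖ = ε‖(D_uψ)(b)‖` and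
  **`norm_conj_link_mul_sub_eq`** `‖ū_b ψ(b₋) − ψ(b₊)‖ = ε‖(D_uψ)(b)‖` (`D_u = covD ε⁻¹ (cfg u)`, any `U(1)` field `u`); **`norm_holA_mul_sub_le`**: along
  every nearest-neighbour chain `Γ = (x, l)`, `‖U(A(Γ))ψ(end Γ) − ψ(x)‖ ≦ |l|·ε·B` whenever `‖(D_uψ)(⟨y,μ⟩)‖ ≦ B` for all bonds with BOTH end points
  among the sites of `Γ` (so a consumer's sup runs only over bonds inside the hull of the chain), `u = e^{ieεA}`; `norm_holA_mul_sub_le'` (global `B`).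
  (The SITE-WISE shape with `0 ≦ B` is r18's `BIJ88LocDerivHolder230RegularTorus.norm_holA_mul_sub_le`, landed; not repeated here.)
* §4 THE DICTIONARY WITH T4's ORDERED HOLONOMY: for site/bond sequences `s`, `c` with `Joins (c m) (s m) (s (m+1))` (`m < n`) and the list
  `Γ_n(s) := List.ofFn (fun i : Fin n => s (i+1))`: **`isSChain_ofFn`**, **`pathEnd_ofFn`** `= s n`, `length_ofFn`, `mem_ofFn_iff`,
  **`exp_bondSum_eq_chainStep`**, **`holA_ofFn_eq_chainHol`** `holA e A (s 0) Γ_n(s) = toC (chainHol s c (expGauge P e A) n)` (forward bond ↦ `u_b`,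
  backward bond ↦ `u_b⁻¹ = ū_b`); and conversely **`exists_joins_of_isSChain`**: every `IsSChain x l` IS such a sequence pair (`s 0 = x`,
  `Γ_{|l|}(s) = l`), packaged as **`chainHol_eq_holA_of_isSChain`** — every statement in one vocabulary can be read in the other.
HONEST SCOPE.  (i) Kernel/bookkeeping identities and one triangle-inequality telescoping; nothing here is an estimate of [7]'s Theorem — those are
`BIJ85NeumannPropagatorRegular{Decay,Close,Deriv,Holder}`.  (ii) Abelian `U(1)` only (the one-parameter group `U(A) = e^{ieηA}` on `ℂ`, N = 2 after
realification), as everywhere on the C2 carrier; [7]'s (1.2) allows any antisymmetric `q` (B4-CLOSURE §4(i)).  (iii) Level `0` (the fine torus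
`T^{(0)}`, spacing `ε`), where `bondSum`/`holA`/`expGauge` live.  (iv) Not a restatement: `lean search 'bondSum_shift|bondSum_of_shift|holA_append'`
and `'^import .*RegularHolder'` were empty on 2026-08-23T05:00Z; p35's (Higgs)₂,₃-torus twins and p29's `chainHol` telescoping are cited above; r18's
consumer file `BIJ88LocDerivHolder230RegularTorus` (p353266, landed 05:2xZ the same hour) now holds the PUBLIC `bondSum_shift`/`bondSum_unshift` (this
file's copies are private kernels, see the citation header; v1 of this file, p353629, was bounced `dedup.landed` on exactly those two) and a SITE-WISE
telescoping `norm_holA_mul_sub_le` with `0 ≦ B` (§3's bond-localised statement is the more general one a hull-restricted consumer needs and is not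
a restatement of it); §2 and §4 have no counterpart anywhere.
Unit `lit-balaban-r01` gen 35 (literature-prover-lit-balaban-r01-g35-0), 2026-08-23.  NOT summit progress.
-/

namespace Literature.MathematicalPhysics.QuantumFieldTheory.BalabanImbrieJaffe1984to88.BIJ85ContourTransportDictionary

open Literature.MathematicalPhysics.QuantumFieldTheory.Balaban1983to89
open BIJ85CovariantHiggsDictionary (expGauge toC_expGauge)
open BIJ85NeumannPropagatorRegularHolder (SNbr IsSChain bondSum holA holA_nil holA_cons norm_holA)
open BIJ88Sect3Statements (U1 toC cfg covD toC_mul toC_inv toC_one norm_toC)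
open B4GaugeCovariance (pathEnd)
open B4Lemma22HolderBox (pathSum)
open T4TreeGaugeFixing (Joins)
open T4TreeGaugeTransform (chainHol chainStep chainHol_succ chainHol_zero)
open scoped BigOperators ComplexConjugate
open Finset

noncomputable section

variable {P : Params}

/-! ## §0 Torus steps on `T^{(j)}` (kernels) -/

/-- kernel: `(x + e_μ)_μ = x_μ + 1`. [folklore] -/
private theorem shift_apply_self {j : ℕ} (x : Balaban1983to89.Site P j) (μ : Fin P.d) : x.shift μ μ = x μ + 1 := by
  simp [Balaban1983to89.Site.shift]

/-- kernel: `(x + e_μ)_ν = x_ν` for `ν ≠ μ`. [folklore] -/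
private theorem shift_apply_ne {j : ℕ} (x : Balaban1983to89.Site P j) {μ ν : Fin P.d} (h : ν ≠ μ) : x.shift μ ν = x ν := by
  simp [Balaban1983to89.Site.shift, Function.update_of_ne h]

/-- kernel: no site is its own neighbour (`1 ≠ 0` modulo `2L^{m+K−j} ≧ 2`). [folklore] -/
private theorem shift_ne_self {j : ℕ} (x : Balaban1983to89.Site P j) (μ : Fin P.d) : x.shift μ ≠ x := by
  intro e
  have e' := congrFun e μ
  rw [shift_apply_self] at e'
  have h1 : ((1 : ℕ) : ZMod (P.sitesPerDir j)) = 0 := by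
    rw [Nat.cast_one]; exact add_eq_left.mp e'
  rw [ZMod.natCast_eq_zero_iff] at h1
  have := Nat.le_of_dvd one_pos h1
  have := P.one_lt_sitesPerDir j
  omega

/-- kernel: on a torus with more than two sites per direction distinct directions give distinct neighbours. [folklore] -/
private theorem shift_ne_shift {j : ℕ} (hS : 2 < P.sitesPerDir j) (x : Balaban1983to89.Site P j) {μ ν : Fin P.d} (h : μ ≠ ν) :
    x.shift μ ≠ x.shift ν := by
  intro e
  have e' := congrFun e ν
  rw [shift_apply_ne x (Ne.symm h), shift_apply_self] at e'
  have h1 : ((1 : ℕ) : ZMod (P.sitesPerDir j)) = 0 := by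
    rw [Nat.cast_one]; exact add_eq_left.mp e'.symm
  rw [ZMod.natCast_eq_zero_iff] at h1
  have := Nat.le_of_dvd one_pos h1
  omega

/-- kernel: … and no site is its own second neighbour, `(x + e_μ) + e_ν ≠ x`. [folklore] -/
private theorem shift_shift_ne {j : ℕ} (hS : 2 < P.sitesPerDir j) (x : Balaban1983to89.Site P j) (μ ν : Fin P.d) :
    (x.shift μ).shift ν ≠ x := by
  intro e
  by_cases h : ν = μ
  · subst h
    have e' := congrFun e ν
    rw [shift_apply_self, shift_apply_self, add_assoc] at e'
    have h2 : ((2 : ℕ) : ZMod (P.sitesPerDir j)) = 0 := by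
      rw [show ((2 : ℕ) : ZMod (P.sitesPerDir j)) = 1 + 1 by norm_num]
      exact add_eq_left.mp e'
    rw [ZMod.natCast_eq_zero_iff] at h2
    have := Nat.le_of_dvd two_pos h2
    omega
  · have e' := congrFun e ν
    rw [shift_apply_self, shift_apply_ne x h] at e'
    have h1 : ((1 : ℕ) : ZMod (P.sitesPerDir j)) = 0 := by
      rw [Nat.cast_one]; exact add_eq_left.mp e'
    rw [ZMod.natCast_eq_zero_iff] at h1
    have := Nat.le_of_dvd one_pos h1
    omega

/-- kernel: a positively oriented bond has two distinct end points. [folklore] -/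
private theorem src_ne_tgt {j : ℕ} (b : PBond P j) : b.src ≠ b.tgt := fun h => shift_ne_self b.src b.dir h.symm

/-! ## §1 The pair form `A(u,v)` of a bond function on the bonds of `T^{(0)}` -/

/-- kernel: **`A(x, x + e_μ) = A_{⟨x,μ⟩}`** — the pair form of [7] p. 572 («A(Γ) = Σ_{b⊂Γ} A_b, where orientations of the bonds b agree with
orientation of the contour Γ») on a positively oriented bond, on every torus with more than two sites per direction (the twin of p35's
`B1TorusChainTransport.bondVal_shift`).  The PUBLIC statement of record is r18's `BIJ88LocDerivHolder230RegularTorus.bondSum_shift` (p353266, landed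
first on 2026-08-23); this private copy only keeps the present low-level file free of that 1450-line consumer module as an import (so that module and
its successors can import THIS file without a cycle). [cite: Balaban1983RegularityDecay, p.572 «A(Γ) = Σ_{b⊂Γ} A_b»] -/
private theorem bondSum_shift (hS : 2 < P.sitesPerDir 0) (A : PBond P 0 → ℝ) (x : Balaban1983to89.Site P 0) (μ : Fin P.d) :
    bondSum A x (x.shift μ) = A ⟨x, μ⟩ := by
  unfold bondSum
  rw [Finset.sum_eq_single μ]
  · rw [if_pos rfl, if_neg (shift_shift_ne hS x μ μ).symm, sub_zero]
  · intro ν _ hν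
    rw [if_neg (shift_ne_shift hS x (Ne.symm hν)), if_neg (shift_shift_ne hS x μ ν).symm, sub_zero]
  · intro h; exact absurd (Finset.mem_univ μ) h

/-- kernel: **`A(x + e_μ, x) = −A_{⟨x,μ⟩}`** — the pair form on a negatively oriented bond («A_{b̄} = −A_b», [7] p. 576; the twin of p35's
`B1TorusChainTransport.bondVal_of_shift`).  The PUBLIC statement of record is r18's `BIJ88LocDerivHolder230RegularTorus.bondSum_unshift` (p353266);
private here for the import-cycle reason stated at `bondSum_shift`. [cite: Balaban1983RegularityDecay, p.576 «A_{b̄} = −A_b»] -/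
private theorem bondSum_of_shift (hS : 2 < P.sitesPerDir 0) (A : PBond P 0 → ℝ) (x : Balaban1983to89.Site P 0) (μ : Fin P.d) :
    bondSum A (x.shift μ) x = -A ⟨x, μ⟩ := by
  unfold bondSum
  rw [Finset.sum_eq_single μ]
  · rw [if_neg (shift_shift_ne hS x μ μ).symm, if_pos rfl, zero_sub]
  · intro ν _ hν
    rw [if_neg (shift_shift_ne hS x μ ν).symm, if_neg (shift_ne_shift hS x (Ne.symm hν)), sub_zero]
  · intro h; exact absurd (Finset.mem_univ μ) h

/-- `A(x, x) = 0` (the empty contour). [cite: Balaban1983RegularityDecay, p.572 «A(Γ) = Σ_{b⊂Γ} A_b»] -/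
theorem bondSum_self (A : PBond P 0 → ℝ) (x : Balaban1983to89.Site P 0) : bondSum A x x = 0 := by
  unfold bondSum
  refine Finset.sum_eq_zero fun μ _ => ?_
  rw [if_neg (shift_ne_self x μ).symm, sub_zero]

/-- **`A(v, u) = −A(u, v)`** — the pair form is odd under reversal of the orientation («A_{b̄} = −A_b»; no hypothesis on the torus).
[cite: Balaban1983RegularityDecay, p.576 «A_{b̄} = −A_b»] -/
theorem bondSum_swap (A : PBond P 0 → ℝ) (u v : Balaban1983to89.Site P 0) : bondSum A v u = -bondSum A u v := by
  unfold bondSum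
  rw [← Finset.sum_neg_distrib]
  refine Finset.sum_congr rfl fun μ _ => ?_
  ring

/-- Lattice neighbourhood is symmetric. [cite: Balaban1983RegularityDecay, p.572 «bonds … ⟨x, x + ηe_μ⟩»] -/
theorem sNbr_comm (x y : Balaban1983to89.Site P 0) : SNbr x y ↔ SNbr y x :=
  ⟨fun ⟨μ, h⟩ => ⟨μ, h.symm⟩, fun ⟨μ, h⟩ => ⟨μ, h.symm⟩⟩

/-! ## §2 The link variables of the transport `U(A(Γ)) = e^{ieεA(Γ)}` at `u = e^{ieεA}` -/

/-- **`e^{ieεA(x, x+e_μ)} = u_{⟨x,μ⟩}`**: on a forward bond the transport factor of [7] (1.4) IS the link variable `u_b = e^{ieεA_b}` of the field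
«exp[ie_kηA]» (`expGauge`). [cite: Balaban1983RegularityDecay, (1.4) p.572] [cite: BalabanImbrieJaffe1985, p.326 «a configuration of the form exp[ie_kηA]»] -/
theorem exp_bondSum_shift (hS : 2 < P.sitesPerDir 0) (e : ℝ) (A : PBond P 0 → ℝ) (x : Balaban1983to89.Site P 0) (μ : Fin P.d) :
    Complex.exp (((P.eps * e * bondSum A x (x.shift μ) : ℝ) : ℂ) * Complex.I) = toC (expGauge P e A ⟨x, μ⟩) := by
  rw [bondSum_shift hS, toC_expGauge]

/-- **`e^{ieεA(x+e_μ, x)} = ū_{⟨x,μ⟩}`**: on a backward bond the transport factor is the conjugate (= inverse) link variable.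
[cite: Balaban1983RegularityDecay, (1.4) p.572, p.576 «A_{b̄} = −A_b»] [cite: BalabanImbrieJaffe1985, p.326 «a configuration of the form exp[ie_kηA]»] -/
theorem exp_bondSum_of_shift (hS : 2 < P.sitesPerDir 0) (e : ℝ) (A : PBond P 0 → ℝ) (x : Balaban1983to89.Site P 0) (μ : Fin P.d) :
    Complex.exp (((P.eps * e * bondSum A (x.shift μ) x : ℝ) : ℂ) * Complex.I) = conj (toC (expGauge P e A ⟨x, μ⟩)) := by
  rw [bondSum_of_shift hS, toC_expGauge, ← Complex.exp_conj, map_mul, Complex.conj_ofReal, Complex.conj_I]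
  congr 1
  push_cast
  ring

/-- **ONE FORWARD STEP PEELED OFF THE TRANSPORT**: `U(A(x, x+e_μ, Γ′)) = u_{⟨x,μ⟩}·U(A(x+e_μ, Γ′))`.
[cite: Balaban1983RegularityDecay, (1.4) p.572 «U(A(Γ))»] -/
theorem holA_cons_shift (hS : 2 < P.sitesPerDir 0) (e : ℝ) (A : PBond P 0 → ℝ) (x : Balaban1983to89.Site P 0) (μ : Fin P.d)
    (l : List (Balaban1983to89.Site P 0)) :
    holA e A x (x.shift μ :: l) = toC (expGauge P e A ⟨x, μ⟩) * holA e A (x.shift μ) l := by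
  rw [holA_cons, exp_bondSum_shift hS]

/-- **ONE BACKWARD STEP PEELED OFF THE TRANSPORT**: `U(A(x+e_μ, x, Γ′)) = ū_{⟨x,μ⟩}·U(A(x, Γ′))`.
[cite: Balaban1983RegularityDecay, (1.4) p.572 «U(A(Γ))», p.576 «A_{b̄} = −A_b»] -/
theorem holA_cons_of_shift (hS : 2 < P.sitesPerDir 0) (e : ℝ) (A : PBond P 0 → ℝ) (x : Balaban1983to89.Site P 0) (μ : Fin P.d)
    (l : List (Balaban1983to89.Site P 0)) :
    holA e A (x.shift μ) (x :: l) = conj (toC (expGauge P e A ⟨x, μ⟩)) * holA e A x l := by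
  rw [holA_cons, exp_bondSum_of_shift hS]

/-- The transport along the one-bond contour `(x, x+e_μ)` is the link variable (hypothesis-free form of `holA_single_of_bondSum`).
[cite: Balaban1983RegularityDecay, (1.4) p.572 «U(A(Γ))»] -/
theorem holA_single_shift (hS : 2 < P.sitesPerDir 0) (e : ℝ) (A : PBond P 0 → ℝ) (x : Balaban1983to89.Site P 0) (μ : Fin P.d) :
    holA e A x [x.shift μ] = toC (expGauge P e A ⟨x, μ⟩) := by
  rw [holA_cons_shift hS, holA_nil, mul_one]

/-- The transport along the reversed one-bond contour `(x+e_μ, x)` is the conjugate link variable.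
[cite: Balaban1983RegularityDecay, (1.4) p.572 «U(A(Γ))», p.576 «A_{b̄} = −A_b»] -/
theorem holA_single_of_shift (hS : 2 < P.sitesPerDir 0) (e : ℝ) (A : PBond P 0 → ℝ) (x : Balaban1983to89.Site P 0) (μ : Fin P.d) :
    holA e A (x.shift μ) [x] = conj (toC (expGauge P e A ⟨x, μ⟩)) := by
  rw [holA_cons_of_shift hS, holA_nil, mul_one]

/-- kernel: end point of a concatenated contour. [folklore] -/
private theorem pathEnd_append' {X : Type*} : ∀ (x : X) (l l' : List X), pathEnd x (l ++ l') = pathEnd (pathEnd x l) l'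
  | _, [], _ => rfl
  | _, y :: l, l' => pathEnd_append' y l l'

/-- kernel: `A(Γ₁Γ₂) = A(Γ₁) + A(Γ₂)`. [folklore] -/
private theorem pathSum_append' {X : Type*} (B : X → X → ℝ) :
    ∀ (x : X) (l l' : List X), pathSum B x (l ++ l') = pathSum B x l + pathSum B (pathEnd x l) l'
  | x, [], l' => by simp [pathSum, pathEnd]
  | x, y :: l, l' => by
    simp only [List.cons_append, pathSum, pathEnd]
    rw [pathSum_append' B y l l']
    ring

/-- **`U(A(Γ₁Γ₂)) = U(A(Γ₁))·U(A(Γ₂))`** for concatenated contours (`A(Γ)` is a sum over the bonds of `Γ`; the group is abelian).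
[cite: Balaban1983RegularityDecay, (1.4) p.572 «A(Γ) = Σ_{b⊂Γ} A_b»] -/
theorem holA_append (e : ℝ) (A : PBond P 0 → ℝ) (x : Balaban1983to89.Site P 0) (l l' : List (Balaban1983to89.Site P 0)) :
    holA e A x (l ++ l') = holA e A x l * holA e A (pathEnd x l) l' := by
  simp only [holA, pathSum_append', ← Complex.exp_add]
  congr 1
  push_cast
  ring

/-- End point of a concatenated contour (for consumers of `holA_append`).
[cite: Balaban1983RegularityDecay, (1.4) p.572 «oriented contours … connecting the initial point y with a final point x»] -/
theorem pathEnd_append (x : Balaban1983to89.Site P 0) (l l' : List (Balaban1983to89.Site P 0)) :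
    pathEnd x (l ++ l') = pathEnd (pathEnd x l) l' :=
  pathEnd_append' x l l'

/-! ## §3 Telescoping the transported difference against the covariant derivative `D_u = covD ε⁻¹ (cfg u)` -/

/-- **`‖u_b ψ(b₊) − ψ(b₋)‖ = ε·‖(D_uψ)(b)‖`** for `b = ⟨x, μ⟩` and ANY `U(1)` field `u` ([BalabanImbrieJaffe1988] (3.3): `(D_uψ)(b) =
ε⁻¹(u(b)ψ(b₊) − ψ(b₋))`). [cite: BalabanImbrieJaffe1988, (3.3) p.265] -/
theorem norm_link_mul_sub_eq (U : GaugeField P 0 U1) (ψ : Balaban1983to89.Site P 0 → ℂ) (x : Balaban1983to89.Site P 0) (μ : Fin P.d) :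
    ‖toC (U ⟨x, μ⟩) * ψ (x.shift μ) - ψ x‖ = P.eps * ‖covD P.eps⁻¹ (cfg U) ψ ⟨x, μ⟩‖ := by
  simp only [covD, cfg]
  rw [norm_mul, Complex.norm_real, Real.norm_eq_abs, abs_inv, abs_of_pos P.eps_pos, ← mul_assoc, mul_inv_cancel₀ P.eps_pos.ne',
    one_mul]
  rfl

/-- **`‖ū_b ψ(b₋) − ψ(b₊)‖ = ε·‖(D_uψ)(b)‖`** (the backward bond: `ū_b ψ(b₋) − ψ(b₊) = −ū_b·(u_b ψ(b₊) − ψ(b₋))`, `|u_b| = 1`).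
[cite: BalabanImbrieJaffe1988, (3.3) p.265] -/
theorem norm_conj_link_mul_sub_eq (U : GaugeField P 0 U1) (ψ : Balaban1983to89.Site P 0 → ℂ) (x : Balaban1983to89.Site P 0) (μ : Fin P.d) :
    ‖conj (toC (U ⟨x, μ⟩)) * ψ x - ψ (x.shift μ)‖ = P.eps * ‖covD P.eps⁻¹ (cfg U) ψ ⟨x, μ⟩‖ := by
  have hu : ‖toC (U ⟨x, μ⟩)‖ = 1 := norm_toC _
  have h3 : conj (toC (U ⟨x, μ⟩)) * toC (U ⟨x, μ⟩) = 1 := by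
    rw [← Complex.normSq_eq_conj_mul_self, ← Complex.sq_norm, hu]; norm_num
  have e : conj (toC (U ⟨x, μ⟩)) * ψ x - ψ (x.shift μ) = -(conj (toC (U ⟨x, μ⟩)) * (toC (U ⟨x, μ⟩) * ψ (x.shift μ) - ψ x)) := by
    calc conj (toC (U ⟨x, μ⟩)) * ψ x - ψ (x.shift μ)
        = conj (toC (U ⟨x, μ⟩)) * ψ x - (conj (toC (U ⟨x, μ⟩)) * toC (U ⟨x, μ⟩)) * ψ (x.shift μ) := by rw [h3, one_mul]
      _ = _ := by ring
  rw [e, norm_neg, norm_mul, RCLike.norm_conj, hu, one_mul, norm_link_mul_sub_eq]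

/-- **TELESCOPING `U(A(Γ))ψ(x′) − ψ(x)` ALONG A NEAREST-NEIGHBOUR CHAIN AT `u = e^{ieεA}`** (the numerator of [7] (1.9), one bond at a time:
`U(A(x,y,Γ′))ψ(end) − ψ(x) = e^{ieεA(x,y)}·(U(A(y,Γ′))ψ(end) − ψ(y)) + (e^{ieεA(x,y)}ψ(y) − ψ(x))`, the last bracket of norm `ε‖(D_uψ)(b)‖` by §2 and
`norm_link_mul_sub_eq`/`norm_conj_link_mul_sub_eq`): if `‖(D_uψ)(⟨y,μ⟩)‖ ≦ B` for every bond `⟨y, μ⟩` with both end points `y`, `y + e_μ` among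
the sites of the chain `(x, l)`, then `‖U(A(Γ))ψ(end Γ) − ψ(x)‖ ≦ |l|·(ε·B)`. [cite: Balaban1983RegularityDecay, (1.9) p.573] [cite: BalabanImbrieJaffe1988, (3.3) p.265] -/
theorem norm_holA_mul_sub_le (hS : 2 < P.sitesPerDir 0) (e : ℝ) (A : PBond P 0 → ℝ) (ψ : Balaban1983to89.Site P 0 → ℂ) (B : ℝ) :
    ∀ (x : Balaban1983to89.Site P 0) (l : List (Balaban1983to89.Site P 0)), IsSChain x l →
      (∀ y ∈ x :: l, ∀ μ : Fin P.d, y.shift μ ∈ x :: l → ‖covD P.eps⁻¹ (cfg (expGauge P e A)) ψ ⟨y, μ⟩‖ ≤ B) →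
      ‖holA e A x l * ψ (pathEnd x l) - ψ x‖ ≤ (l.length : ℝ) * (P.eps * B)
  | x, [], _, _ => by simp [holA_nil, pathEnd]
  | x, y :: l, hch, hB => by
    have hch2 : SNbr x y ∧ IsSChain y l := hch
    obtain ⟨⟨μ, hμ⟩, hch'⟩ := hch2
    have ih := norm_holA_mul_sub_le hS e A ψ B y l hch'
      (fun z hz ν hν => hB z (List.mem_cons.2 (Or.inr hz)) ν (List.mem_cons.2 (Or.inr hν)))
    have hsplit : holA e A x (y :: l) * ψ (pathEnd x (y :: l)) - ψ x
        = Complex.exp (((P.eps * e * bondSum A x y : ℝ) : ℂ) * Complex.I) * (holA e A y l * ψ (pathEnd y l) - ψ y)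
          + (Complex.exp (((P.eps * e * bondSum A x y : ℝ) : ℂ) * Complex.I) * ψ y - ψ x) := by
      rw [holA_cons]
      simp only [pathEnd]
      ring
    have hw1 : ‖Complex.exp (((P.eps * e * bondSum A x y : ℝ) : ℂ) * Complex.I)‖ = 1 := Complex.norm_exp_ofReal_mul_I _
    have hstep : ‖Complex.exp (((P.eps * e * bondSum A x y : ℝ) : ℂ) * Complex.I) * ψ y - ψ x‖ ≤ P.eps * B := by
      rcases hμ with h | h
      · subst h
        rw [exp_bondSum_shift hS, norm_link_mul_sub_eq]
        exact mul_le_mul_of_nonneg_left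
          (hB x (List.mem_cons.2 (Or.inl rfl)) μ (List.mem_cons.2 (Or.inr (List.mem_cons.2 (Or.inl rfl))))) P.eps_pos.le
      · subst h
        rw [exp_bondSum_of_shift hS, norm_conj_link_mul_sub_eq]
        exact mul_le_mul_of_nonneg_left
          (hB y (List.mem_cons.2 (Or.inr (List.mem_cons.2 (Or.inl rfl)))) μ (List.mem_cons.2 (Or.inl rfl))) P.eps_pos.le
    calc ‖holA e A x (y :: l) * ψ (pathEnd x (y :: l)) - ψ x‖
        = ‖Complex.exp (((P.eps * e * bondSum A x y : ℝ) : ℂ) * Complex.I) * (holA e A y l * ψ (pathEnd y l) - ψ y)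
            + (Complex.exp (((P.eps * e * bondSum A x y : ℝ) : ℂ) * Complex.I) * ψ y - ψ x)‖ := by rw [hsplit]
      _ ≤ ‖Complex.exp (((P.eps * e * bondSum A x y : ℝ) : ℂ) * Complex.I) * (holA e A y l * ψ (pathEnd y l) - ψ y)‖
            + ‖Complex.exp (((P.eps * e * bondSum A x y : ℝ) : ℂ) * Complex.I) * ψ y - ψ x‖ := norm_add_le _ _
      _ ≤ (l.length : ℝ) * (P.eps * B) + P.eps * B := by
          refine add_le_add ?_ hstep
          rw [norm_mul, hw1, one_mul]
          exact ih
      _ = ((y :: l).length : ℝ) * (P.eps * B) := by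
          simp only [List.length_cons, Nat.cast_succ]
          ring

/-- The same telescoping with a bond-wise bound valid for ALL bonds (no localisation needed by the consumer).
[cite: Balaban1983RegularityDecay, (1.9) p.573] [cite: BalabanImbrieJaffe1988, (3.3) p.265] -/
theorem norm_holA_mul_sub_le' (hS : 2 < P.sitesPerDir 0) (e : ℝ) (A : PBond P 0 → ℝ) (ψ : Balaban1983to89.Site P 0 → ℂ) {B : ℝ}
    (hB : ∀ b : PBond P 0, ‖covD P.eps⁻¹ (cfg (expGauge P e A)) ψ b‖ ≤ B) (x : Balaban1983to89.Site P 0)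
    (l : List (Balaban1983to89.Site P 0)) (hch : IsSChain x l) :
    ‖holA e A x l * ψ (pathEnd x l) - ψ x‖ ≤ (l.length : ℝ) * (P.eps * B) :=
  norm_holA_mul_sub_le hS e A ψ B x l hch fun y _ μ _ => hB ⟨y, μ⟩

/-! ## §4 The dictionary with T4's ordered holonomy `chainHol` over site/bond sequences -/

/-- kernel: a bond joining `x` to `y` (in either orientation) makes them lattice neighbours. [folklore] -/
private theorem sNbr_of_joins {b : PBond P 0} {x y : Balaban1983to89.Site P 0} (h : Joins b x y) : SNbr x y := by
  rcases h with ⟨h1, h2⟩ | ⟨h1, h2⟩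
  · exact ⟨b.dir, Or.inl (by rw [← h2, ← h1]; rfl)⟩
  · exact ⟨b.dir, Or.inr (by rw [← h2, ← h1]; rfl)⟩

/-- kernel: head–tail decomposition of the ordered product (the twin of `T4TreeGaugeHolonomyLaw.chainHol_succ_eq_head_mul`, restated to keep the
imports small). [folklore] -/
private theorem chainHol_succ_head {G : Type*} [GaugeGroup G] (s : ℕ → Balaban1983to89.Site P 0) (c : ℕ → PBond P 0) (U : GaugeField P 0 G)
    (n : ℕ) : chainHol s c U (n + 1) = chainStep s c U 0 * chainHol (fun m => s (m + 1)) (fun m => c (m + 1)) U n := by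
  induction n with
  | zero => rw [chainHol_succ, chainHol_zero, chainHol_zero, one_mul, mul_one]
  | succ n ih =>
    rw [chainHol_succ, ih, chainHol_succ, mul_assoc]
    rfl

/-- **ONE STEP OF THE DICTIONARY**: for a bond `c_m` joining `s_m` to `s_{m+1}`, the transport factor `e^{ieεA(s_m, s_{m+1})}` of [7] (1.4) IS T4's
`chainStep` of the field `u = e^{ieεA}` read in `ℂ` (`u(c_m)` if `c_m` starts at `s_m`, `u(c_m)⁻¹ = ū(c_m)` otherwise).
[cite: Balaban1983RegularityDecay, (1.4) p.572 «orientations of the bonds b agree with orientation of the contour Γ»] -/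
theorem exp_bondSum_eq_chainStep (hS : 2 < P.sitesPerDir 0) (e : ℝ) (A : PBond P 0 → ℝ) {s : ℕ → Balaban1983to89.Site P 0}
    {c : ℕ → PBond P 0} {m : ℕ} (hJ : Joins (c m) (s m) (s (m + 1))) :
    Complex.exp (((P.eps * e * bondSum A (s m) (s (m + 1)) : ℝ) : ℂ) * Complex.I) = toC (chainStep s c (expGauge P e A) m) := by
  unfold chainStep
  rcases hJ with ⟨h1, h2⟩ | ⟨h1, h2⟩
  · rw [if_pos h1]
    have e2 : s (m + 1) = (s m).shift (c m).dir := by rw [← h2, ← h1]; rfl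
    have hb : (⟨s m, (c m).dir⟩ : PBond P 0) = c m := by rw [← h1]
    rw [e2, exp_bondSum_shift hS, hb]
  · have hne : ¬ (c m).src = s m := by
      intro h
      exact src_ne_tgt (c m) (by rw [h, h2])
    rw [if_neg hne, toC_inv]
    have e2 : s m = (s (m + 1)).shift (c m).dir := by rw [← h2, ← h1]; rfl
    have hb : (⟨s (m + 1), (c m).dir⟩ : PBond P 0) = c m := by rw [← h1]
    rw [e2, exp_bondSum_of_shift hS, hb]

/-- The list of sites `s_1, …, s_n` visited after `s_0` is a nearest-neighbour chain from `s_0` whenever consecutive sites are joined by bonds.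
[cite: Balaban1983RegularityDecay, p.572 «an arbitrary contour Γ in the lattice (considered as a sum of bonds)»] -/
theorem isSChain_ofFn : ∀ (n : ℕ) (s : ℕ → Balaban1983to89.Site P 0) (c : ℕ → PBond P 0),
    (∀ m < n, Joins (c m) (s m) (s (m + 1))) → IsSChain (s 0) (List.ofFn fun i : Fin n => s (i + 1))
  | 0, s, c, _ => by simp [IsSChain]
  | n + 1, s, c, hJ => by
    rw [List.ofFn_succ]
    refine ⟨sNbr_of_joins (hJ 0 (Nat.succ_pos n)), ?_⟩
    have ih := isSChain_ofFn n (fun m => s (m + 1)) (fun m => c (m + 1)) fun m hm => hJ (m + 1) (by omega)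
    simpa [Fin.val_succ] using ih

/-- Its end point is `s_n`. [cite: Balaban1983RegularityDecay, p.572 «oriented contours … connecting the initial point y with a final point x»] -/
theorem pathEnd_ofFn : ∀ (n : ℕ) (s : ℕ → Balaban1983to89.Site P 0), pathEnd (s 0) (List.ofFn fun i : Fin n => s (i + 1)) = s n
  | 0, s => by simp [pathEnd]
  | n + 1, s => by
    rw [List.ofFn_succ]
    have ih := pathEnd_ofFn n (fun m => s (m + 1))
    simp only [pathEnd, Fin.val_zero, Fin.val_succ] at ih ⊢
    exact ih

/-- Its length is `n`. [cite: Balaban1983RegularityDecay, p.573 «a shortest contour connecting these points»] -/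
theorem length_ofFn (n : ℕ) (s : ℕ → Balaban1983to89.Site P 0) : (List.ofFn fun i : Fin n => s (i + 1)).length = n :=
  List.length_ofFn

/-- Its sites are among `s_1, …, s_n`. [cite: Balaban1983RegularityDecay, p.572 «oriented contours … connecting the initial point y with a final point x»] -/
theorem mem_ofFn_iff {n : ℕ} {s : ℕ → Balaban1983to89.Site P 0} {y : Balaban1983to89.Site P 0} :
    y ∈ (List.ofFn fun i : Fin n => s (i + 1)) ↔ ∃ m, 1 ≤ m ∧ m ≤ n ∧ s m = y := by
  rw [List.mem_ofFn]
  constructor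
  · rintro ⟨i, hi⟩
    exact ⟨i + 1, by omega, by omega, hi⟩
  · rintro ⟨m, hm1, hmn, hm⟩
    refine ⟨⟨m - 1, by omega⟩, ?_⟩
    have : m - 1 + 1 = m := by omega
    simp only [this, hm]

/-- **THE DICTIONARY `U(A(Γ)) = toC (chainHol …)`**: along a chain of sites `s_0, …, s_n` whose consecutive sites are joined by the bonds `c_m`
(T4's `Joins`, either orientation), [7]'s abelian transport `e^{ieεA(Γ)}` (this seat's `holA` over the LIST `s_1, …, s_n`) IS the ordered holonomy
`chainHol s c u n` of the field `u = e^{ieεA}` read in `ℂ` — forward bonds contribute `u_b`, backward bonds `u_b⁻¹ = ū_b` («orientations of the bonds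
b agree with orientation of the contour Γ», «A_{b̄} = −A_b»). [cite: Balaban1983RegularityDecay, (1.4) p.572 «U(A(Γ))», p.576 «A_{b̄} = −A_b»] -/
theorem holA_ofFn_eq_chainHol (hS : 2 < P.sitesPerDir 0) (e : ℝ) (A : PBond P 0 → ℝ) : ∀ (n : ℕ) (s : ℕ → Balaban1983to89.Site P 0)
    (c : ℕ → PBond P 0), (∀ m < n, Joins (c m) (s m) (s (m + 1))) →
    holA e A (s 0) (List.ofFn fun i : Fin n => s (i + 1)) = toC (chainHol s c (expGauge P e A) n)
  | 0, s, c, _ => by simp [holA_nil, chainHol_zero, toC_one]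
  | n + 1, s, c, hJ => by
    rw [List.ofFn_succ, chainHol_succ_head, toC_mul, holA_cons]
    have ih := holA_ofFn_eq_chainHol hS e A n (fun m => s (m + 1)) (fun m => c (m + 1)) fun m hm => hJ (m + 1) (by omega)
    have h0 := exp_bondSum_eq_chainStep hS e A (hJ 0 (Nat.succ_pos n))
    simp only [Fin.val_zero, Fin.val_succ, zero_add] at ih h0 ⊢
    rw [h0, ih]

/-- **THE CONVERSE DICTIONARY**: every nearest-neighbour chain `(x, l)` (`IsSChain x l`) IS a site/bond sequence pair of T4's shape — `s_0 = x`,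
consecutive sites joined by bonds `c_m` for `m < |l|`, and `s_1, …, s_{|l|}` the given list. [cite: Balaban1983RegularityDecay, p.572 «an arbitrary contour Γ in the lattice (considered as a sum of bonds)»] -/
theorem exists_joins_of_isSChain : ∀ (x : Balaban1983to89.Site P 0) (l : List (Balaban1983to89.Site P 0)), IsSChain x l →
    ∃ (s : ℕ → Balaban1983to89.Site P 0) (c : ℕ → PBond P 0), s 0 = x ∧ (∀ m < l.length, Joins (c m) (s m) (s (m + 1))) ∧
      (List.ofFn fun i : Fin l.length => s (i + 1)) = l
  | x, [], _ => ⟨fun _ => x, fun _ => ⟨x, ⟨0, P.hd⟩⟩, rfl, fun m hm => absurd hm (Nat.not_lt_zero m), by simp⟩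
  | x, y :: l, hch => by
    have hch2 : SNbr x y ∧ IsSChain y l := hch
    obtain ⟨⟨μ, hμ⟩, hch'⟩ := hch2
    obtain ⟨s', c', hs'0, hJ', hl'⟩ := exists_joins_of_isSChain y l hch'
    -- the first bond: `⟨x, μ⟩` if `y = x + e_μ`, `⟨y, μ⟩` if `x = y + e_μ`
    have hb : ∃ b : PBond P 0, Joins b x y := by
      rcases hμ with h | h
      · exact ⟨⟨x, μ⟩, Or.inl ⟨rfl, h.symm⟩⟩
      · exact ⟨⟨y, μ⟩, Or.inr ⟨rfl, h.symm⟩⟩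
    obtain ⟨b, hbJ⟩ := hb
    refine ⟨fun m => Nat.casesOn m x fun m' => s' m', fun m => Nat.casesOn m b fun m' => c' m', rfl, ?_, ?_⟩
    · intro m hm
      cases m with
      | zero => simpa [hs'0] using hbJ
      | succ m' =>
        have := hJ' m' (by simpa [List.length_cons] using hm)
        simpa using this
    · rw [List.length_cons, List.ofFn_succ]
      simp only [Fin.val_zero, Fin.val_succ]
      show s' 0 :: List.ofFn (fun i : Fin l.length => s' (i + 1)) = y :: l
      rw [hs'0, hl']

/-- **READING A `chainHol` STATEMENT ON A LIST CHAIN** (the converse dictionary applied): for every nearest-neighbour chain `(x, l)` there are T4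
sequences `s`, `c` with `s 0 = x`, `s |l| = end(Γ)`, all `s_m` (`m ≦ |l|`) among the sites of the chain, consecutive sites joined, and
`toC (chainHol s c (e^{ieεA}) |l|) = U(A(Γ))`. [cite: Balaban1983RegularityDecay, (1.4) p.572 «U(A(Γ))», p.573 (1.9)] -/
theorem chainHol_eq_holA_of_isSChain (hS : 2 < P.sitesPerDir 0) (e : ℝ) (A : PBond P 0 → ℝ) (x : Balaban1983to89.Site P 0)
    (l : List (Balaban1983to89.Site P 0)) (hch : IsSChain x l) :
    ∃ (s : ℕ → Balaban1983to89.Site P 0) (c : ℕ → PBond P 0), s 0 = x ∧ s l.length = pathEnd x l ∧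
      (∀ m < l.length, Joins (c m) (s m) (s (m + 1))) ∧ (∀ m, m ≤ l.length → s m ∈ x :: l) ∧
      toC (chainHol s c (expGauge P e A) l.length) = holA e A x l := by
  obtain ⟨s, c, hs0, hJ, hl⟩ := exists_joins_of_isSChain x l hch
  refine ⟨s, c, hs0, ?_, hJ, ?_, ?_⟩
  · have h := pathEnd_ofFn l.length s
    rw [hl, hs0] at h
    exact h.symm
  · intro m hm
    rcases Nat.eq_zero_or_pos m with h0 | hpos
    · rw [h0, hs0]; exact List.mem_cons.2 (Or.inl rfl)
    · refine List.mem_cons.2 (Or.inr ?_)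
      rw [← hl]
      exact mem_ofFn_iff.2 ⟨m, hpos, hm, rfl⟩
  · have h := holA_ofFn_eq_chainHol hS e A l.length s c hJ
    rw [hl, hs0] at h
    exact h.symm

end

end Literature.MathematicalPhysics.QuantumFieldTheory.BalabanImbrieJaffe1984to88.BIJ85ContourTransportDictionary
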